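import Literature.MathematicalPhysics.QuantumFieldTheory.Balaban1983to89.B6SectALemma24TwoLevelV1

/-!
# `Balaban1983to89.B6SectALemma24TwoLevelV1Sites` — T. Bałaban, *Propagators and renormalization transformations for lattice gauge theories. II*,
# Commun. Math. Phys. **96** (1984) 223–250 [Balaban1984PropagatorsII], Lemma 2.4 (2.128) p. 245 for the TWO-LEVEL CUBE (2.89) p. 239:
# **THE TWO-SCALE LEMMA-2.4 LETTER WITH TORUS-SIDE HYPOTHESES** (the cube's blocks as sites of `T^{(j)}`, `T^{(j+1)}`; index facts in `LamBond` language)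

statement-level skeleton of published theorems with citation tags; proofs where landed; nothing here is a claim about the Yang–Mills mass gap

PDF held: `paper:balaban1984-cmp96-propagators-rt-ii` (journal page = PDF page + 222), pp. 239, 244–245.

CITATION HEADER (lean-in-tree rule).  Cell `pub-ymgap` (Track A, HUMAN RULING D-0062), node N10 [B13] lane owner `pub-ymgap-dag-n10-c` (g18), ROAD «C» station C6d
(bus INBOX 2026-08-28T19:08Z INTENT-3), filed `--supports stmt-QuantumFields-27364` (count-neutral helper).  WHY: dag-n06-j's W0 (b) composition for ONE-LEVEL cubes
(`B9LocalLemma24AtLettersY.local_lemma24_real` → `Summits/…/BalabanUVNodesN06Row17LocalCentreOfLemma24Letter`) consumes the V1 Lemma-2.4 letter through a thin def-Y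
wrapper whose inputs are TORUS-side data: the set of the cube's blocks as sites of `T^{(j)}`, the vanishing of the configuration off the cube (`hoff`), its corner staircase
sums, and the index facts as `LamBond` statements.  The two-level letter of `B6SectALemma24TwoLevelV1` (C6c, `lemma24_letter_twoLevel_noAdm`) is stated over LABEL
corners `Λs ⊂ Lʲℤᵈ`, `Λb ⊂ L^{j+1}ℤᵈ` of the period box; THIS FILE re-keys it to the same torus-side shape for a cube MEETING `Ω_{j+1}`, so that the def-Y wrapper for
interface cubes is the one-level wrapper verbatim (plus the label margins — wrapping cubes go through the torus charts, the standing restriction of `B6GlobalChartV1` (3)).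
IMPORTS `B6SectALemma24TwoLevelV1` (C6c v1.1 p658465); nothing restated.

THE PRINT (verbatim, p. 245): *«L^{d−2} Σ_{c∈Λ′} |(Q₁B)(c)|² + Σ_p |(∂₁B)(p)|² ≥ (1∕(12d²)) L^{−d−1} ‖B‖². (2.128)»*; p. 239: *«We define B^j(Λ) = □̃ ∩ B^{j+1}(Λ_{j+1}),
(2.89) and we take Q′*aQ′, Q*aQ equal to Q′*_{j+1}a_{j+1}Q′_{j+1}, Q*_{j+1}a_{j+1}Q_{j+1} on B^j(Λ), and to Q′*_ja_jQ′_j, Q*_ja_jQ_j on □̃ ∖ B^j(Λ)»*; p. 224 (2.3): the index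
bonds `Λ_j` (*«at least one end-point … belongs to»* `Ω_j^{(j)}`, no end point inside `Ω_{j+1}` — r03's `Domains.LamBond`).

WHAT IS PROVED (sorry-free; standard axioms; label∕site bookkeeping [folklore] over C6c ∕ C4):
* §1 ★ `labSite_toZ_cornerV1` (`labSite k ∘ labels = id`), `toZ_cornerV1_injective`, `toZ_cornerV1_mem_coarseSites`, ★ `corner_big_toZ_cornerV1` (the `L^{j+1}`-corner of
  the labels of `Bʲ(y)` = the labels of `B^{j+1}(blockOf y)`), ★ `blockOf_labSite` (`blockOf ∘ labSite j = labSite (j+1) ∘ corner_{L^{j+1}}` on coarse labels),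
  `corner_mem_coarseSites`, ★ `labSite_add_smul` (`labSite k (z + Lᵏe_μ) = (labSite k z).shift μ`).
* §2 ★★★ **`lemma24_letter_twoLevel_sites`**: for a nested `D : Domains P`, `j + 1 ≤ k`, finite `S ⊆ T^{(j)}` (the cube's level-`j` blocks), `T ⊆ T^{(j+1)}` (its big
  blocks, INCLUDING the empty big blocks of `Ω_{j+1}` adjacent to its level-`j` part), `blockOf y ∉ T` for `y ∈ S`, label margins of one big block (ℕ arithmetic on
  `(y i).val·Lʲ`), the INDEX FACTS `∀ bb : PBond P j, (bb.src ∈ S ∨ bb.tgt ∈ S) → blockOf bb.src ∉ T → blockOf bb.tgt ∉ T → D.LamBond j bb` and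
  `∀ BB : PBond P (j+1), (BB.src ∈ T ∨ BB.tgt ∈ T) → D.LamBond (j+1) BB`, weights `w ≥ w₀ ≥ 0`, and `B : BondSpace P` carried by bonds with an end point in a block of
  `S` or `T` (`hoff`) with vanishing corner staircase sums on those blocks ⟹ **`κ·‖B‖² ≤ ‖dcE c B‖² + Σ_i w_i (QE D B)_i²`**,
  `κ = (12d²(1 + 12d·L^{2j}))⁻¹·((L^{j+1})^{d+1})⁻¹·min(c²/2, w₀/(L^{j+1})^{d−2})` — `lemma24_letter_twoLevel_noAdm` at `Λs := labels of S`, `Λb := labels of T`, its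
  `hsupp` by `supp_of_torusSupport`, its `hIS`∕`hIB` from the torus-language index facts through §1.
HONEST SCOPE.  Re-keying only; the estimate is C6b's kernel theorem through C6c.  The index facts and the margins are the consumer's cube geometry ((2.2): no block of
`Ω_{j+2}` and no wrap-around within one big block of the cube; the big blocks of `Ω_{j+1}` adjacent to the cube's level-`j` part are put into `T` so that every level-`j`
face of the cube joins two non-deep blocks); constants level-dependent as C4∕C6c.  NOT a node discharge; count-neutral; nothing continuum ∕ OS ∕ mass gap ∕ Clay.
-/

open scoped InnerProductSpace

namespace Literature.MathematicalPhysics.QuantumFieldTheory.Balaban1983to89.B6SectALemma24TwoLevelV1Sites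

open Finset
open LatticeFieldCalculus B5Eq118OneStroke B5Eq120IterProof B6SectADomainsV1 B6SectAOperatorsV1
open BalabanImbrieJaffe1984to88.BIJ85AxialPropagator411 (BondSpace)
open B6Lemma24Torus (pbox mem_pbox coarseSites mem_coarseSites)
open B6Elimination (corner corner_apply corner_le)
open B6BondElimination (unitVec unitVec_apply add_unitVec_apply add_smul_unitVec_apply)
open B6TreeGaugePoincare (Cfg)
open B6Lemma24Carrier (lam mem_lam lamBonds mem_lamBonds coarseBonds)
open B6Lemma24Assembly (mem_coarseBonds dvd_of_mem_coarseBonds)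
open B6Lemma24TwoScaleBookkeeping (bonds₂ idxS mem_idxS idxS_subset)
open B6SectALemma24OneLevelV1 (castZ toZ cornerV1 periodV1 toZ_cornerV1 toZ_mem_block_of_mem_iterBlock toZ_mem_pbox)
open B6SectALemma24TwoLevelV1 (labSite labBond toZ_cornerV1_labSite supp_of_torusSupport lemma24_letter_twoLevel_noAdm)

noncomputable section

variable {P : Params}

/-! ## §1. Labels ↔ sites: `labSite ∘ label = id`, the big corner of a label, `blockOf ∘ labSite`, shifts -/

section Labels

variable {k : ℕ}

/-- ★ `labSite k (labels of the corner of Bᵏ(y)) = y`. [cite: Balaban1984PropagatorsI, (1.6) p.18; folklore] -/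
theorem labSite_toZ_cornerV1 (hk : k ≤ P.m + P.K) (y : Site P k) : labSite k (toZ (cornerV1 k y)) = y := by
  funext i
  have hLk : (0 : ℤ) < (P.L : ℤ) ^ k := pow_pos (by exact_mod_cast P.L_pos) k
  simp only [labSite]
  rw [toZ_cornerV1 hk]
  push_cast
  rw [Int.mul_ediv_cancel _ hLk.ne', Int.toNat_natCast, ZMod.natCast_zmod_val]

/-- the label map `y ↦ labels of the corner of Bᵏ(y)` is injective. [cite: Balaban1984PropagatorsI, (1.6) p.18; folklore] -/
theorem toZ_cornerV1_injective (hk : k ≤ P.m + P.K) : Function.Injective fun y : Site P k => toZ (cornerV1 k y) := by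
  intro y y' h
  have := congrArg (labSite (P := P) k) h
  simp only [labSite_toZ_cornerV1 hk] at this
  exact this

/-- the labels of a corner are coarse sites of the box. [cite: Balaban1984PropagatorsI, (1.6) p.18; folklore] -/
theorem toZ_cornerV1_mem_coarseSites (hk : k ≤ P.m + P.K) (y : Site P k) : toZ (cornerV1 k y) ∈ coarseSites (P.L ^ k) (periodV1 P) :=
  mem_coarseSites.2 ⟨toZ_mem_pbox _, fun i => by rw [toZ_cornerV1 hk]; push_cast; exact Dvd.intro_left _ rfl⟩

/-- ★ the big corner of the labels of `Bʲ(y)` is the label vector of `B^{j+1}(blockOf y)`. [cite: Balaban1984PropagatorsI, (1.6) p.18, (1.16) p.20; folklore] -/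
theorem corner_big_toZ_cornerV1 {j : ℕ} (hj : j + 1 ≤ P.m + P.K) (y : Site P j) :
    corner (P.L ^ j * P.L) (toZ (cornerV1 j y)) = toZ (cornerV1 (j + 1) (blockOf y)) := by
  have hj0 : j ≤ P.m + P.K := le_trans (Nat.le_succ j) hj
  funext i
  rw [corner_apply, toZ_cornerV1 hj0, toZ_cornerV1 hj, Site.val_blockOf hj, ← Int.natCast_div, ← Int.natCast_mul]
  congr 1
  rw [show (y i).val * P.L ^ j / (P.L ^ j * P.L) = (y i).val / P.L by
    rw [mul_comm (P.L ^ j) P.L, Nat.mul_div_mul_right _ _ (pow_pos P.L_pos j)], pow_succ]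
  ring

/-- ★ `blockOf (labSite j z) = labSite (j+1) (corner_{L^{j+1}} z)` for a coarse label `z`. [cite: Balaban1984PropagatorsI, (1.6) p.18, (1.16) p.20; folklore] -/
theorem blockOf_labSite {j : ℕ} (hj : j + 1 ≤ P.m + P.K) {z : Fin P.d → ℤ} (hz : z ∈ coarseSites (P.L ^ j) (periodV1 P)) :
    blockOf (labSite (P := P) j z) = labSite (j + 1) (corner (P.L ^ j * P.L) z) := by
  have hj0 : j ≤ P.m + P.K := le_trans (Nat.le_succ j) hj
  conv_rhs => rw [← toZ_cornerV1_labSite hj0 hz, corner_big_toZ_cornerV1 hj, labSite_toZ_cornerV1 hj]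

/-- the big corner of a point of the box is a coarse site of the box at the big scale. [cite: Balaban1984PropagatorsI, (1.6) p.18; folklore] -/
theorem corner_mem_coarseSites {N : ℕ} (hN : 1 ≤ N) {z : Fin P.d → ℤ} (hz : z ∈ pbox (periodV1 P)) : corner N z ∈ coarseSites N (periodV1 P) := by
  refine mem_coarseSites.2 ⟨mem_pbox.2 fun i => ?_, fun i => by rw [corner_apply]; exact dvd_mul_right _ _⟩
  obtain ⟨h0, h1⟩ := mem_pbox.1 hz i
  have hN0 : (0 : ℤ) < N := by exact_mod_cast hN
  refine ⟨?_, lt_of_le_of_lt (corner_le hN z i) h1⟩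
  rw [corner_apply]
  exact mul_nonneg hN0.le (Int.ediv_nonneg h0 hN0.le)

/-- ★ one step of the coarse lattice in labels: `labSite k (z + Lᵏe_μ) = (labSite k z).shift μ` for `z ≥ 0`. [cite: Balaban1984PropagatorsI, (1.6) p.18; folklore] -/
theorem labSite_add_smul {z : Fin P.d → ℤ} (hz : ∀ i, 0 ≤ z i) (μ : Fin P.d) :
    labSite (P := P) k (z + ((P.L ^ k : ℕ) : ℤ) • unitVec μ) = (labSite k z).shift μ := by
  have hLk : (0 : ℤ) < (P.L : ℤ) ^ k := pow_pos (by exact_mod_cast P.L_pos) k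
  funext i
  show ((((z + ((P.L ^ k : ℕ) : ℤ) • unitVec μ) i / (P.L : ℤ) ^ k).toNat : ℕ) : ZMod (P.sitesPerDir k)) =
    Function.update (labSite k z) μ (labSite k z μ + 1) i
  rw [add_smul_unitVec_apply]
  by_cases hi : i = μ
  · subst hi
    rw [Function.update_self, if_pos rfl]
    show _ = (((z i / (P.L : ℤ) ^ k).toNat : ℕ) : ZMod (P.sitesPerDir k)) + 1
    have hq0 : 0 ≤ z i / (P.L : ℤ) ^ k := Int.ediv_nonneg (hz i) hLk.le
    have e : (z i + ((P.L ^ k : ℕ) : ℤ)) / (P.L : ℤ) ^ k = z i / (P.L : ℤ) ^ k + 1 := by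
      rw [Nat.cast_pow, show z i + (P.L : ℤ) ^ k = z i + 1 * (P.L : ℤ) ^ k by ring, Int.add_mul_ediv_right _ _ hLk.ne']
    rw [e, show z i / (P.L : ℤ) ^ k + 1 = (((z i / (P.L : ℤ) ^ k).toNat + 1 : ℕ) : ℤ) by push_cast; rw [Int.toNat_of_nonneg hq0],
      Int.toNat_natCast, Nat.cast_succ]
  · rw [Function.update_of_ne hi, if_neg hi, add_zero]; rfl

end Labels

/-! ## §2. ★★★ The two-scale Lemma-2.4 letter with torus-side hypotheses -/

section Sites

variable {j : ℕ}

/-- ★★★ **THE LEMMA-2.4 LETTER OF C1 FOR A CUBE MEETING `Ω_{j+1}`, TORUS-SIDE HYPOTHESES** (the consumption shape of n06-j's one-level `local_lemma24_real`).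
Data: a nested family `D` with `j + 1 ≤ k`; finite sets `S ⊆ T^{(j)}` (the cube's blocks of order `j`) and `T ⊆ T^{(j+1)}` (its blocks of order `j+1`, INCLUDING the
empty big blocks of `Ω_{j+1}` adjacent to its level-`j` part), `blockOf y ∉ T` for `y ∈ S` (disjoint regions); label margins of one big block off the box boundary
(`hboxS`, `hboxT`, on the labels `(y i).val·Lʲ` — wrapping cubes go through the torus charts); the INDEX FACTS in `LamBond` language — every bond of `T^{(j)}` with an
end in `S` and no end block in `T` is an index of level `j` (`hIS`), every bond of `T^{(j+1)}` meeting `T` is an index of level `j+1` (`hIB`) —; weights `w ≥ w₀ ≥ 0`;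
a configuration `B` carried by bonds with an end point in a block of `S` or of `T` (`hoff`) whose corner staircase sums vanish on those blocks ((2.121), C2's class).
Then **`κ·‖B‖² ≤ ‖∂B‖² + Σ_𝔅 w·(QB)²`**, `κ = (12d²(1 + 12d·L^{2j}))⁻¹·((L^{j+1})^{d+1})⁻¹·min(c²/2, w₀/(L^{j+1})^{d−2})`
(`lemma24_letter_twoLevel_noAdm` at `Λs := labels of S`, `Λb := labels of T`). [cite: Balaban1984PropagatorsII, Lemma 2.4 (2.128) p.245, (2.19) p.226, (2.89) p.239, (2.121) p.244, (2.3) p.224] -/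
theorem lemma24_letter_twoLevel_sites (hd : 2 ≤ P.d) (D : Domains P) (hjk : j + 1 ≤ D.k) (S : Finset (Site P j)) (T : Finset (Site P (j + 1)))
    (hST : ∀ y ∈ S, blockOf y ∉ T)
    (hboxS : ∀ y ∈ S, ∀ i, P.L ^ (j + 1) ≤ (y i).val * P.L ^ j ∧ (y i).val * P.L ^ j + P.L ^ j + P.L ^ (j + 1) ≤ P.sitesPerDir 0)
    (hboxT : ∀ Y ∈ T, ∀ i, P.L ^ (j + 1) ≤ (Y i).val * P.L ^ (j + 1) ∧ (Y i).val * P.L ^ (j + 1) + 2 * P.L ^ (j + 1) ≤ P.sitesPerDir 0)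
    (hIS : ∀ bb : PBond P j, (bb.src ∈ S ∨ bb.tgt ∈ S) → blockOf bb.src ∉ T → blockOf bb.tgt ∉ T → D.LamBond j bb)
    (hIB : ∀ BB : PBond P (j + 1), (BB.src ∈ T ∨ BB.tgt ∈ T) → D.LamBond (j + 1) BB)
    (c : ℝ) {w : BondIdx D → ℝ} {w₀ : ℝ} (hw₀ : 0 ≤ w₀) (hw : ∀ i, w₀ ≤ w i) (B : BondSpace P)
    (hoff : ∀ b : PBond P 0, WithLp.ofLp B b ≠ 0 →
      (∃ y ∈ S, b.src ∈ iterBlock j y ∨ b.tgt ∈ iterBlock j y) ∨ (∃ Y ∈ T, b.src ∈ iterBlock (j + 1) Y ∨ b.tgt ∈ iterBlock (j + 1) Y))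
    (hTs : ∀ y ∈ S, ∀ x ∈ iterBlock j y, stairSum (WithLp.ofLp B) (cornerV1 j y) x = 0)
    (hTb : ∀ Y ∈ T, ∀ x ∈ iterBlock (j + 1) Y, stairSum (WithLp.ofLp B) (cornerV1 (j + 1) Y) x = 0) :
    (12 * (P.d : ℝ) ^ 2 * (1 + 12 * (P.d : ℝ) * ((P.L : ℝ) ^ j) ^ 2))⁻¹ * (((P.L : ℝ) ^ (j + 1)) ^ (P.d + 1))⁻¹ *
        min (c ^ 2 / 2) (w₀ / ((P.L : ℝ) ^ (j + 1)) ^ (P.d - 2)) * ‖B‖ ^ 2 ≤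
      ‖dcE c B‖ ^ 2 + ∑ i, w i * QE D B i ^ 2 := by
  classical
  have hj : j + 1 ≤ P.m + P.K := le_trans hjk D.hk
  have hj0 : j ≤ P.m + P.K := le_trans (Nat.le_succ j) hj
  have hn1 : 1 ≤ P.L ^ j := Nat.one_le_pow _ _ P.L_pos
  have hN1 : 1 ≤ P.L ^ (j + 1) := Nat.one_le_pow _ _ P.L_pos
  have hnN : P.L ^ j ≤ P.L ^ (j + 1) := Nat.pow_le_pow_right P.L_pos (Nat.le_succ j)
  have hNn : P.L ^ j * P.L = P.L ^ (j + 1) := (pow_succ P.L j).symm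
  -- the label corners
  set Λs : Finset (Fin P.d → ℤ) := S.image fun y => toZ (cornerV1 j y) with hΛsdef
  set Λb : Finset (Fin P.d → ℤ) := T.image fun Y => toZ (cornerV1 (j + 1) Y) with hΛbdef
  have hΛs : ∀ y ∈ Λs, ∀ i, ((P.L ^ j : ℕ) : ℤ) ∣ y i := by
    intro y hy i; obtain ⟨yk, -, rfl⟩ := mem_image.1 hy; rw [toZ_cornerV1 hj0]; push_cast; exact Dvd.intro_left _ rfl
  have hΛb : ∀ Y ∈ Λb, ∀ i, ((P.L ^ (j + 1) : ℕ) : ℤ) ∣ Y i := by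
    intro Y hY i; obtain ⟨Yk, -, rfl⟩ := mem_image.1 hY; rw [toZ_cornerV1 hj]; push_cast; exact Dvd.intro_left _ rfl
  have hboxS' : ∀ y ∈ Λs, ∀ i, ((P.L ^ (j + 1) : ℕ) : ℤ) ≤ y i ∧ y i + ((P.L ^ j : ℕ) : ℤ) + ((P.L ^ (j + 1) : ℕ) : ℤ) ≤ ((P.sitesPerDir 0 : ℕ) : ℤ) := by
    intro y hy i
    obtain ⟨yk, hyk, rfl⟩ := mem_image.1 hy
    have e : toZ (cornerV1 j yk) i = (((yk i).val * P.L ^ j : ℕ) : ℤ) := toZ_cornerV1 hj0 yk i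
    obtain ⟨h1, h2⟩ := hboxS yk hyk i
    have h1' := Int.ofNat_le.mpr h1
    have h2' := Int.ofNat_le.mpr h2
    rw [e]
    push_cast at h1' h2' ⊢
    exact ⟨by linarith, by linarith⟩
  have hboxT' : ∀ Y ∈ Λb, ∀ i, ((P.L ^ (j + 1) : ℕ) : ℤ) ≤ Y i ∧ Y i + 2 * ((P.L ^ (j + 1) : ℕ) : ℤ) ≤ ((P.sitesPerDir 0 : ℕ) : ℤ) := by
    intro Y hY i
    obtain ⟨Yk, hYk, rfl⟩ := mem_image.1 hY
    have e : toZ (cornerV1 (j + 1) Yk) i = (((Yk i).val * P.L ^ (j + 1) : ℕ) : ℤ) := toZ_cornerV1 hj Yk i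
    obtain ⟨h1, h2⟩ := hboxT Yk hYk i
    have h1' := Int.ofNat_le.mpr h1
    have h2' := Int.ofNat_le.mpr h2
    rw [e]
    push_cast at h1' h2' ⊢
    exact ⟨by linarith, by linarith⟩
  -- disjointness
  have hdisj : ∀ y ∈ Λs, corner (P.L ^ j * P.L) y ∉ Λb := by
    intro y hy hmem
    obtain ⟨yk, hyk, rfl⟩ := mem_image.1 hy
    rw [corner_big_toZ_cornerV1 hj] at hmem
    obtain ⟨Yk, hYk, hYe⟩ := mem_image.1 hmem
    exact hST yk hyk (by rw [← toZ_cornerV1_injective hj hYe]; exact hYk)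
  -- box facts for labels and their neighbours
  have hn1Z : (1 : ℤ) ≤ ((P.L ^ j : ℕ) : ℤ) := Int.ofNat_le.mpr hn1
  have hnNZ : ((P.L ^ j : ℕ) : ℤ) ≤ ((P.L ^ (j + 1) : ℕ) : ℤ) := Int.ofNat_le.mpr hnN
  have hcsS : ∀ cc ∈ idxS (P.L ^ j) P.L Λs Λb,
      cc.1 ∈ coarseSites (P.L ^ j) (periodV1 P) ∧ cc.1 + ((P.L ^ j : ℕ) : ℤ) • unitVec cc.2 ∈ coarseSites (P.L ^ j) (periodV1 P) := by
    intro cc hcc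
    have hcb := idxS_subset Λs Λb hcc
    have hdv : ∀ i, ((P.L ^ j : ℕ) : ℤ) ∣ cc.1 i := dvd_of_mem_coarseBonds hΛs hcb
    have hbounds : ∀ i, 0 ≤ cc.1 i ∧ cc.1 i + 2 * ((P.L ^ j : ℕ) : ℤ) ≤ ((P.sitesPerDir 0 : ℕ) : ℤ) := by
      intro i
      rcases mem_coarseBonds.1 hcb with h1 | h1
      · have := hboxS' _ h1 i; constructor <;> omega
      · have := hboxS' _ h1 i
        rw [add_smul_unitVec_apply] at this
        split_ifs at this <;> constructor <;> omega
    refine ⟨mem_coarseSites.2 ⟨mem_pbox.2 fun i => ⟨(hbounds i).1, ?_⟩, hdv⟩, mem_coarseSites.2 ⟨mem_pbox.2 fun i => ?_, fun i => ?_⟩⟩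
    · show cc.1 i < ((P.sitesPerDir 0 : ℕ) : ℤ); have := hbounds i; omega
    · have := hbounds i
      rw [add_smul_unitVec_apply]
      show 0 ≤ cc.1 i + (if i = cc.2 then ((P.L ^ j : ℕ) : ℤ) else 0) ∧ cc.1 i + (if i = cc.2 then ((P.L ^ j : ℕ) : ℤ) else 0) < ((P.sitesPerDir 0 : ℕ) : ℤ)
      split_ifs <;> constructor <;> omega
    · rw [add_smul_unitVec_apply]; exact dvd_add (hdv i) (by split_ifs <;> simp)
  have hcsB : ∀ C ∈ coarseBonds (P.L ^ (j + 1)) Λb,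
      C.1 ∈ coarseSites (P.L ^ (j + 1)) (periodV1 P) ∧ C.1 + ((P.L ^ (j + 1) : ℕ) : ℤ) • unitVec C.2 ∈ coarseSites (P.L ^ (j + 1)) (periodV1 P) := by
    intro C hC
    have hdv : ∀ i, ((P.L ^ (j + 1) : ℕ) : ℤ) ∣ C.1 i := dvd_of_mem_coarseBonds hΛb hC
    have hbounds : ∀ i, 0 ≤ C.1 i ∧ C.1 i + 2 * ((P.L ^ (j + 1) : ℕ) : ℤ) ≤ ((P.sitesPerDir 0 : ℕ) : ℤ) := by
      intro i
      rcases mem_coarseBonds.1 hC with h1 | h1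
      · have := hboxT' _ h1 i; constructor <;> omega
      · have := hboxT' _ h1 i
        rw [add_smul_unitVec_apply] at this
        split_ifs at this <;> constructor <;> omega
    refine ⟨mem_coarseSites.2 ⟨mem_pbox.2 fun i => ⟨(hbounds i).1, ?_⟩, hdv⟩, mem_coarseSites.2 ⟨mem_pbox.2 fun i => ?_, fun i => ?_⟩⟩
    · show C.1 i < ((P.sitesPerDir 0 : ℕ) : ℤ); have := hbounds i; omega
    · have := hbounds i
      rw [add_smul_unitVec_apply]
      show 0 ≤ C.1 i + (if i = C.2 then ((P.L ^ (j + 1) : ℕ) : ℤ) else 0) ∧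
        C.1 i + (if i = C.2 then ((P.L ^ (j + 1) : ℕ) : ℤ) else 0) < ((P.sitesPerDir 0 : ℕ) : ℤ)
      split_ifs <;> constructor <;> omega
    · rw [add_smul_unitVec_apply]; exact dvd_add (hdv i) (by split_ifs <;> simp)
  -- the index facts, from the torus-language hypotheses
  have hnotT : ∀ z ∈ pbox (periodV1 P), corner (P.L ^ j * P.L) z ∉ Λb → labSite (P := P) (j + 1) (corner (P.L ^ j * P.L) z) ∉ T := by
    intro z hz hzb hmem
    apply hzb
    have hcs : corner (P.L ^ j * P.L) z ∈ coarseSites (P.L ^ (j + 1)) (periodV1 P) := by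
      rw [hNn]; exact corner_mem_coarseSites hN1 hz
    have e := toZ_cornerV1_labSite hj hcs
    rw [hNn] at e ⊢
    exact mem_image.2 ⟨_, hmem, e⟩
  have hIS' : ∀ cc ∈ idxS (P.L ^ j) P.L Λs Λb, D.LamBond j (labBond j cc) := by
    intro cc hcc
    obtain ⟨hcb, hc1, hc2⟩ := mem_idxS.1 hcc
    obtain ⟨hz1, hz2⟩ := hcsS cc hcc
    have hz1p := (mem_coarseSites.1 hz1).1
    have hz2p := (mem_coarseSites.1 hz2).1
    have hz0 : ∀ i, 0 ≤ cc.1 i := fun i => (mem_pbox.1 hz1p i).1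
    have htgt : (labBond (P := P) j cc).tgt = labSite j (cc.1 + ((P.L ^ j : ℕ) : ℤ) • unitVec cc.2) := by
      show (labSite j cc.1).shift cc.2 = _; rw [labSite_add_smul hz0]
    refine hIS (labBond j cc) ?_ ?_ ?_
    · rcases mem_coarseBonds.1 hcb with h1 | h1
      · obtain ⟨yk, hyk, hye⟩ := mem_image.1 h1
        exact Or.inl (by show labSite j cc.1 ∈ S; rw [← hye, labSite_toZ_cornerV1 hj0]; exact hyk)
      · obtain ⟨yk, hyk, hye⟩ := mem_image.1 h1
        refine Or.inr ?_
        rw [htgt, ← hye, labSite_toZ_cornerV1 hj0]; exact hyk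
    · show blockOf (labSite j cc.1) ∉ T
      rw [blockOf_labSite hj hz1]
      exact hnotT _ hz1p hc1
    · rw [htgt, blockOf_labSite hj hz2]
      exact hnotT _ hz2p hc2
  have hIB' : ∀ C ∈ coarseBonds (P.L ^ (j + 1)) Λb, D.LamBond (j + 1) (labBond (j + 1) C) := by
    intro C hC
    obtain ⟨hz1, -⟩ := hcsB C hC
    have hz0 : ∀ i, 0 ≤ C.1 i := fun i => (mem_pbox.1 (mem_coarseSites.1 hz1).1 i).1
    refine hIB (labBond (j + 1) C) ?_
    rcases mem_coarseBonds.1 hC with h1 | h1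
    · obtain ⟨Yk, hYk, hYe⟩ := mem_image.1 h1
      exact Or.inl (by show labSite (j + 1) C.1 ∈ T; rw [← hYe, labSite_toZ_cornerV1 hj]; exact hYk)
    · obtain ⟨Yk, hYk, hYe⟩ := mem_image.1 h1
      refine Or.inr ?_
      show (labSite (j + 1) C.1).shift C.2 ∈ T
      rw [← labSite_add_smul hz0, ← hYe, labSite_toZ_cornerV1 hj]; exact hYk
  -- the support hypothesis in label form
  have hU1 : ∀ u ∈ lam (P.L ^ j) Λs ∪ lam (P.L ^ j * P.L) Λb, ∀ i, 1 ≤ u i := by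
    intro u hu i
    rcases mem_union.1 hu with hu | hu
    · obtain ⟨y, hy, huy⟩ := mem_lam.1 hu
      have := (B6Elimination.mem_block.1 huy i).1; have := (hboxS' y hy i).1; omega
    · rw [hNn] at hu
      obtain ⟨Y, hY, huY⟩ := mem_lam.1 hu
      have := (B6Elimination.mem_block.1 huY i).1; have := (hboxT' Y hY i).1; omega
  have hB : ∀ b : PBond P 0, WithLp.ofLp B b ≠ 0 →
      toZ b.src ∈ lam (P.L ^ j) Λs ∪ lam (P.L ^ j * P.L) Λb ∨ toZ (b.src.shift b.dir) ∈ lam (P.L ^ j) Λs ∪ lam (P.L ^ j * P.L) Λb := by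
    intro b hb
    rcases hoff b hb with ⟨y, hy, h⟩ | ⟨Y, hY, h⟩
    · have hmem : ∀ x, x ∈ iterBlock j y → toZ x ∈ lam (P.L ^ j) Λs ∪ lam (P.L ^ j * P.L) Λb := fun x hx =>
        mem_union_left _ (mem_lam.2 ⟨_, mem_image_of_mem _ hy, toZ_mem_block_of_mem_iterBlock hj0 y hx⟩)
      rcases h with h | h
      · exact Or.inl (hmem _ h)
      · exact Or.inr (hmem _ h)
    · have hmem : ∀ x, x ∈ iterBlock (j + 1) Y → toZ x ∈ lam (P.L ^ j) Λs ∪ lam (P.L ^ j * P.L) Λb := fun x hx =>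
        mem_union_right _ (by rw [hNn]; exact mem_lam.2 ⟨_, mem_image_of_mem _ hY, toZ_mem_block_of_mem_iterBlock hj Y hx⟩)
      rcases h with h | h
      · exact Or.inl (hmem _ h)
      · exact Or.inr (hmem _ h)
  have hsupp := supp_of_torusSupport (n := P.L ^ j) (L := P.L) hU1 B hB
  -- the staircase sums at the label sites
  have hTs' : ∀ y ∈ Λs, ∀ x ∈ iterBlock j (labSite j y), stairSum (WithLp.ofLp B) (cornerV1 j (labSite j y)) x = 0 := by
    intro y hy; obtain ⟨yk, hyk, rfl⟩ := mem_image.1 hy; rw [labSite_toZ_cornerV1 hj0]; exact hTs yk hyk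
  have hTb' : ∀ Y ∈ Λb, ∀ x ∈ iterBlock (j + 1) (labSite (j + 1) Y), stairSum (WithLp.ofLp B) (cornerV1 (j + 1) (labSite (j + 1) Y)) x = 0 := by
    intro Y hY; obtain ⟨Yk, hYk, rfl⟩ := mem_image.1 hY; rw [labSite_toZ_cornerV1 hj]; exact hTb Yk hYk
  exact lemma24_letter_twoLevel_noAdm hd D hjk hΛs hΛb hboxS' hboxT' hdisj hIS' hIB' c hw₀ hw B hsupp hTs' hTb'

end Sites

end

end Literature.MathematicalPhysics.QuantumFieldTheory.Balaban1983to89.B6SectALemma24TwoLevelV1Sites
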